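import Mathlib
import HarnessLib
import Literature.MathematicalPhysics.StatisticalMechanics.TorusMultiplierMatrices
import Literature.MathematicalPhysics.QuantumFieldTheory.GaussianCovarianceComparisonTraceVector

/-!
# The dimension-free Gaussian comparison for Fourier-multiplier covariances on the torus:
# `|E_{N(0,mulMat m₁)} H − E_{N(0,mulMat m₀)} H| ≤ 8q · (Σ_κ (1 − m₀(κ)/m₁(κ))²)^{1/2} · ‖H‖_{L^p}`
# ([Buc16] Thm 4.5 / [ABKM19] Lemma 8.4 (`ℓ = 1`) preparation, "all operators are diagonal in Fourier space")

`StepMeasureRegularisation.abs_dotProduct_mulMat_inv_sub_le` turns mode-wise closeness of two even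
positive multipliers into the precision sandwich consumed by the CRUDE comparison
`abs_integral_multivariateGaussian_sub_le` (constant `gaussCompConst(|Λ|, q)`, exponential in the number of
modes).  This file is the analogous bridge for the DIMENSION-FREE comparison
`GaussianCovarianceComparisonTrace.abs_integral_multivariateGaussian_sub_le_of_trace`, whose price is the
Hilbert–Schmidt size `tr((1 − S₀S₁⁻¹)²)`: for multiplier matrices this trace is the explicit mode sum
`Σ_κ (1 − m₀(κ)/m₁(κ))²` ([ABKM19] Remark 7.4), so that modes where the two multipliers agree to high
relative precision (the high momenta of a finite-range decomposition, [Buc16] (4.36)) contribute their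
SQUARED relative difference only.

* `trace_mulMat_one_sub_inv_mul_sq` — `tr((mulMat m₀ ((mulMat m₀)⁻¹ − (mulMat m₁)⁻¹))²) = Σ_κ (1 − m₀(κ)/m₁(κ))²`;
* **`abs_integral_mulMat_sub_le_of_sum_sq`** (real `H`) and **`norm_integral_mulMat_sub_le_of_sum_sq`**
  (Banach-valued `H`): for even multipliers `m₀, m₁ > 0` with `Σ_κ (1 − m₀(κ)/m₁(κ))² ≤ h²`,
  `0 ≤ h ≤ 1/(4q)`: `‖∫ H dN(0, mulMat m₁) − ∫ H dN(0, mulMat m₀)‖ ≤ 8 q h (∫ ‖H‖^p dN(0, mulMat m₀))^{1/p}`.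

Everything is proved; no named fact.  (The remaining steps of the volume-uniform [ABKM19] Lemma 8.4 —
localisation of an `X`-local functional to a torus of side `≈ 2 diam X*` by the finite range, and the shell
arithmetic `Σ_{κ≠0} (1 − m₀/m₁)² ≤ C(L)(diam X*/L^k)^d` — are NOT here.)

## References
* S. Buchholz, J. Funct. Anal. 275 (2018), Thm 4.5 and (4.36)–(4.37) [Buchholz2016].
* S. Adams, S. Buchholz, R. Kotecký, S. Müller, arXiv:1910.13564, Remark 7.4, Theorem 6.2, Lemma 8.4
  [AdamsBuchholzKoteckyMuller2019].
-/

noncomputable section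

namespace Literature.MathematicalPhysics.StatisticalMechanics.GradientRG

open scoped BigOperators Matrix
open MeasureTheory ProbabilityTheory Finset WithLp
open Literature.MathematicalPhysics.StatisticalMechanics.GradientFRD (mulMat mulMat_mul mulMat_one
  mulMat_inv mulMat_sub trace_mulMat posDef_mulMat)
open Literature.MathematicalPhysics.QuantumFieldTheory

variable {d M : ℕ} [NeZero M]

/-! ## The Hilbert–Schmidt datum of two multiplier covariances -/

/-- `mulMat m₀ ((mulMat m₀)⁻¹ − (mulMat m₁)⁻¹) = mulMat (1 − m₀/m₁)` for even nowhere-vanishing multipliers.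
[cite: AdamsBuchholzKoteckyMuller2019, Remark 7.4] -/
theorem mulMat_mul_inv_sub_inv {m₀ m₁ : (Fin d → ZMod M) → ℝ} (h0 : ∀ κ, m₀ κ ≠ 0) (h1 : ∀ κ, m₁ κ ≠ 0)
    (he0 : ∀ κ, m₀ (-κ) = m₀ κ) (he1 : ∀ κ, m₁ (-κ) = m₁ κ) :
    mulMat m₀ * ((mulMat m₀)⁻¹ - (mulMat m₁)⁻¹) = mulMat (fun κ => 1 - m₀ κ / m₁ κ) := by
  rw [mulMat_inv he0 h0, mulMat_inv he1 h1, ← mulMat_sub,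
    mulMat_mul he0 (fun κ => by simp only [he0, he1])]
  congr 1; funext κ
  rw [mul_sub, mul_inv_cancel₀ (h0 κ), div_eq_mul_inv]

/-- **`tr((mulMat m₀((mulMat m₀)⁻¹ − (mulMat m₁)⁻¹))²) = Σ_κ (1 − m₀(κ)/m₁(κ))²`**: the Hilbert–Schmidt size of
the change of covariance between two multiplier Gaussians is the mode sum of the squared relative
differences. [cite: Buchholz2016, Thm 4.5 (proof, (4.36))] -/
theorem trace_mulMat_one_sub_inv_mul_sq {m₀ m₁ : (Fin d → ZMod M) → ℝ} (h0 : ∀ κ, m₀ κ ≠ 0)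
    (h1 : ∀ κ, m₁ κ ≠ 0) (he0 : ∀ κ, m₀ (-κ) = m₀ κ) (he1 : ∀ κ, m₁ (-κ) = m₁ κ) :
    ((mulMat m₀ * ((mulMat m₀)⁻¹ - (mulMat m₁)⁻¹)) * (mulMat m₀ * ((mulMat m₀)⁻¹ - (mulMat m₁)⁻¹))).trace
      = ∑ κ, (1 - m₀ κ / m₁ κ) ^ 2 := by
  have hev : ∀ κ, (fun κ => 1 - m₀ κ / m₁ κ) (-κ) = (fun κ => 1 - m₀ κ / m₁ κ) κ := fun κ => by
    simp only [he0, he1]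
  rw [mulMat_mul_inv_sub_inv h0 h1 he0 he1, mulMat_mul hev hev, trace_mulMat]
  exact sum_congr rfl fun κ _ => by ring

/-! ## The comparison for multiplier covariances -/

/-- **Dimension-free comparison of two multiplier Gaussians, real functionals**: for even multipliers
`m₀, m₁ > 0` with `Σ_κ (1 − m₀(κ)/m₁(κ))² ≤ h²`, `0 ≤ h ≤ 1/(4q)`, `p, q` Hölder conjugate and
`H ∈ L^p(N(0, mulMat m₀))`:
`|∫ H dN(0, mulMat m₁) − ∫ H dN(0, mulMat m₀)| ≤ 8 q h · (∫ |H|^p dN(0, mulMat m₀))^{1/p}`.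
[cite: Buchholz2016, Thm 4.5] -/
theorem abs_integral_mulMat_sub_le_of_sum_sq {m₀ m₁ : (Fin d → ZMod M) → ℝ} (h0 : ∀ κ, 0 < m₀ κ)
    (h1 : ∀ κ, 0 < m₁ κ) (he0 : ∀ κ, m₀ (-κ) = m₀ κ) (he1 : ∀ κ, m₁ (-κ) = m₁ κ) {h : ℝ} (hh0 : 0 ≤ h)
    (hsum : ∑ κ, (1 - m₀ κ / m₁ κ) ^ 2 ≤ h ^ 2)
    {p q : ℝ} (hpq : p.HolderConjugate q) (hhq : h ≤ 1 / (4 * q))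
    {H : EuclideanSpace ℝ (Fin d → ZMod M) → ℝ}
    (hH : MemLp H (ENNReal.ofReal p) (multivariateGaussian 0 (mulMat m₀))) :
    |∫ y, H y ∂(multivariateGaussian 0 (mulMat m₁)) - ∫ y, H y ∂(multivariateGaussian 0 (mulMat m₀))| ≤
      8 * q * h * (∫ y, |H y| ^ p ∂(multivariateGaussian 0 (mulMat m₀))) ^ (1 / p) := by
  have htr : ((mulMat m₀ * ((mulMat m₀)⁻¹ - (mulMat m₁)⁻¹)) *
      (mulMat m₀ * ((mulMat m₀)⁻¹ - (mulMat m₁)⁻¹))).trace ≤ h ^ 2 := by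
    rw [trace_mulMat_one_sub_inv_mul_sq (fun κ => (h0 κ).ne') (fun κ => (h1 κ).ne') he0 he1]
    exact hsum
  exact abs_integral_multivariateGaussian_sub_le_of_trace (posDef_mulMat h0) (posDef_mulMat h1) hh0 htr
    hpq hhq hH

/-- **Dimension-free comparison of two multiplier Gaussians, Banach-valued functionals** (the form
[ABKM19] Lemma 8.4 (`ℓ = 1`) consumes, with the multilinear maps `D^s K(φ + ζ)`): for even multipliers
`m₀, m₁ > 0` with `Σ_κ (1 − m₀(κ)/m₁(κ))² ≤ h²`, `0 ≤ h ≤ 1/(4q)`, `H ∈ L^p(N(0, mulMat m₀))` and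
`N(0, mulMat m₁)`-integrable:
`‖∫ H dN(0, mulMat m₁) − ∫ H dN(0, mulMat m₀)‖ ≤ 8 q h · (∫ ‖H‖^p dN(0, mulMat m₀))^{1/p}`.
[cite: Buchholz2016, Thm 4.5] -/
theorem norm_integral_mulMat_sub_le_of_sum_sq {m₀ m₁ : (Fin d → ZMod M) → ℝ} (h0 : ∀ κ, 0 < m₀ κ)
    (h1 : ∀ κ, 0 < m₁ κ) (he0 : ∀ κ, m₀ (-κ) = m₀ κ) (he1 : ∀ κ, m₁ (-κ) = m₁ κ) {h : ℝ} (hh0 : 0 ≤ h)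
    (hsum : ∑ κ, (1 - m₀ κ / m₁ κ) ^ 2 ≤ h ^ 2)
    {p q : ℝ} (hpq : p.HolderConjugate q) (hhq : h ≤ 1 / (4 * q))
    {F : Type*} [NormedAddCommGroup F] [NormedSpace ℝ F] [CompleteSpace F]
    {H : EuclideanSpace ℝ (Fin d → ZMod M) → F}
    (hH : MemLp H (ENNReal.ofReal p) (multivariateGaussian 0 (mulMat m₀)))
    (hH₁ : Integrable H (multivariateGaussian 0 (mulMat m₁))) :
    ‖∫ y, H y ∂(multivariateGaussian 0 (mulMat m₁)) - ∫ y, H y ∂(multivariateGaussian 0 (mulMat m₀))‖ ≤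
      8 * q * h * (∫ y, ‖H y‖ ^ p ∂(multivariateGaussian 0 (mulMat m₀))) ^ (1 / p) := by
  have htr : ((mulMat m₀ * ((mulMat m₀)⁻¹ - (mulMat m₁)⁻¹)) *
      (mulMat m₀ * ((mulMat m₀)⁻¹ - (mulMat m₁)⁻¹))).trace ≤ h ^ 2 := by
    rw [trace_mulMat_one_sub_inv_mul_sq (fun κ => (h0 κ).ne') (fun κ => (h1 κ).ne') he0 he1]
    exact hsum
  exact norm_integral_multivariateGaussian_sub_le_of_trace (posDef_mulMat h0) (posDef_mulMat h1) hh0 htr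
    hpq hhq hH hH₁

end Literature.MathematicalPhysics.StatisticalMechanics.GradientRG

end
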